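import Mathlib
import Literature.Algebra.EuclideanLattices.EncodingProofs

/-!
# PneNP / LatticeMagic — `BooleanSosBlindAtEveryFactor` (stmt-PneNP-16059): bit-size of bounded instances

Helper file (`--supports stmt-PneNP-16059`) for the support item
`Summit.PneNP.PneNP.Theses.LatticeMagic.BooleanSosBlindAtEveryFactor` (road A of the planner's plan:
the Construction-A `GapCVP` instance with its check block scaled by a factor `M = 2^T`). Since the
scaled instance has entries as large as `2M`, the crux's size stub `stub_encode` (entries `≤ 2`,
`LatticeMagicBooleanSosBlindAtConstantFactorStubEncode.lean`) does not apply; this file proves the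
LOGARITHMIC version for an ARBITRARY instance `((⟨n, B⟩, t), K)` with integer entries of absolute value
`≤ A` and natural threshold `K`:

  `|code ((⟨n, B⟩, t), K)| ≤ 100 · ((n + 1)² · (⌊log₂ A⌋ + 1) + ⌊log₂ K⌋ + 1)`

(`bounded_encode_le`) — "the size of the input of a lattice problem is the number of bits of the
integer data", polynomial in the dimension and the bit length of the entries.

**Proof.** Pure length bookkeeping on the Boolean encodings fixed in
`Literature/Algebra/EuclideanLattices/Encoding.lean` (`gapCVPInstanceEncoding =
cvpInstanceEncoding.pairBool encodingRatBool`): definitionally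
`code ((⟨n, B⟩, t), d) = ⟨⟨bin n, ⟨code B, code t⟩⟩, ⟨encodeInt d.num, bin d.den⟩⟩` with the
self-delimiting pairing `|⟨x, y⟩| = 2|x| + 2 + |y|` (`length_boolPair`). The `listBool` codes of
the `n²` basis entries and the `n` target entries cost `2 · (#entries) + 2 + Σ (2 |encodeInt e| + 2)`
bits with `|encodeInt e| ≤ ⌊log₂ |e|⌋ + 7 ≤ ⌊log₂ A⌋ + 7` (`length_encodeInt_le_holds` of
`EncodingProofs.lean`, `Nat.log_mono_right`), the header costs `|bin n| ≤ ⌊log₂ n⌋ + 3 ≤ n + 3`, and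
the threshold `2 (⌊log₂ K⌋ + 7) + 3`; summing, with `L = ⌊log₂ A⌋`,
`|code| ≤ 72 n² + 8 n² L + 4 n L + 40 n + 2 ⌊log₂ K⌋ + 51 ≤ 100 ((n + 1)² (L + 1) + ⌊log₂ K⌋ + 1)`.

Sources: D. Micciancio, S. Goldwasser, *Complexity of Lattice Problems: A Cryptographic
Perspective* (Kluwer 2002), Ch. 1, §1.3 ("size of the input"); S. Arora, B. Barak, *Computational
Complexity: A Modern Approach* (CUP 2009), §0.1 (representing integers, tuples and matrices as
strings). Nothing is cited as a fact: everything here is proved from the tree's encoders (the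
bookkeeping lemmas of the crux's `…StubEncode.lean` are private there and re-proved here).
-/

set_option linter.dupNamespace false -- summit = sub-problem (D-0017)

namespace Summit.PneNP.PneNP.Theorems.ConAScaled

open Computability Literature.Algebra.EuclideanLattices Literature.Computability.Complexity

/-! ### Lengths of the building blocks (bookkeeping after `EncodingProofs.lean`) -/

/-- The `listBool` code of `List.ofFn v` (`v : Fin m → ℤ`) with entries of absolute value `≤ A` has
length `≤ 2 m + 2 + m (2 ⌊log₂ A⌋ + 16)`: each framed entry costs `2 |encodeInt z| + 2` bits with
`|encodeInt z| ≤ ⌊log₂ |z|⌋ + 7 ≤ ⌊log₂ A⌋ + 7` (`length_encodeInt_le_holds`, monotonicity of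
`log₂`; Arora–Barak 2009, §0.1). [folklore] -/
theorem boundedEncode_length_listBool_ofFn_le {m : ℕ} (v : Fin m → ℤ) (A : ℕ)
    (hv : ∀ k, (v k).natAbs ≤ A) :
    (encodingIntBool.listBool.encode (List.ofFn v)).length ≤
      2 * m + 2 + m * (2 * Nat.log 2 A + 16) := by
  -- length of a `listBool` code: unary length header, then each component `boolPair`-framed
  -- (cf. `length_encode_listBool` of `FregeProofs.lean`, not imported to keep the cone small)
  have H : ∀ l : List ℤ, (l.foldr (fun a acc => boolPair (encodingIntBool.encode a) acc) []).length
      = (l.map fun a => 2 * (encodingIntBool.encode a).length + 2).sum := by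
    intro l
    induction l with
    | nil => rfl
    | cons a l ih =>
      simp only [List.foldr_cons, length_boolPair, ih, List.map_cons, List.sum_cons]
  have hlen : (encodingIntBool.listBool.encode (List.ofFn v)).length =
      2 * m + 2 + ((List.ofFn v).map fun a => 2 * (encodingIntBool.encode a).length + 2).sum := by
    simp only [Encoding.listBool, length_boolPair, H, List.length_ofFn]
    have hu : (unaryEncodeNat m).length = m := unary_decode_encode_nat m
    omega
  -- each framed entry costs at most `2 (⌊log₂ A⌋ + 7) + 2` bits
  have hterm : ∀ a ∈ List.ofFn v, 2 * (encodingIntBool.encode a).length + 2 ≤ 2 * Nat.log 2 A + 16 := by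
    intro a ha
    obtain ⟨k, rfl⟩ := List.mem_ofFn.1 ha
    have h1 : (encodeInt (v k)).length ≤ Nat.log 2 (v k).natAbs + 7 := length_encodeInt_le_holds _
    have h2 : Nat.log 2 (v k).natAbs ≤ Nat.log 2 A := Nat.log_mono_right (hv k)
    change 2 * (encodeInt (v k)).length + 2 ≤ _
    omega
  -- a list sum of bounded terms (cf. `sum_map_le_length_mul` of `OracleComposition.lean`)
  have hsum : ∀ l : List ℤ, (∀ a ∈ l, 2 * (encodingIntBool.encode a).length + 2 ≤ 2 * Nat.log 2 A + 16) →
      (l.map fun a => 2 * (encodingIntBool.encode a).length + 2).sum ≤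
        l.length * (2 * Nat.log 2 A + 16) := by
    intro l hl
    induction l with
    | nil => simp
    | cons a l ih =>
      simp only [List.map_cons, List.sum_cons, List.length_cons]
      have ha := hl a (by simp)
      have hl' := ih fun b hb => hl b (by simp [hb])
      nlinarith [ha, hl']
  have h := hsum (List.ofFn v) hterm
  rw [List.length_ofFn] at h
  omega

/-- `|encodeNat m| ≤ ⌊log₂ m⌋ + 3`, read off `|encodeInt m| = |encodeNat m| + 4 ≤ ⌊log₂ m⌋ + 7`
(`length_encodeInt_eq`, `length_encodeInt_le_holds`; Arora–Barak 2009, §0.1). [folklore] -/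
theorem boundedEncode_length_encodeNat_le (m : ℕ) : (encodeNat m).length ≤ Nat.log 2 m + 3 := by
  have h1 := length_encodeInt_eq (m : ℤ)
  have h2 : (encodeInt (m : ℤ)).length ≤ Nat.log 2 (m : ℤ).natAbs + 7 :=
    length_encodeInt_le_holds _
  rw [Int.natAbs_natCast] at h1 h2
  omega

/-! ### The pieces of the code of an instance with natural threshold -/

/-- Unfolding the code of `((⟨n, B⟩, t), d)` into its `boolPair` fields:
`⟨⟨bin n, ⟨code B, code t⟩⟩, code d⟩` (definitional; Micciancio–Goldwasser 2002, Ch. 1, §1.2, the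
data of a `GapCVP` instance). [folklore] -/
theorem boundedEncode_encode_eq (n : ℕ) (B : Matrix (Fin n) (Fin n) ℤ) (t : Fin n → ℤ) (d : ℚ) :
    GapCVPInstance.encode ((⟨⟨n, B⟩, t⟩, d) : GapCVPInstance) =
      boolPair (boolPair (encodeNat n)
        (boolPair ((encodingIntMatrixFin n).encode B) ((encodingIntVecFin n).encode t)))
        (encodingRatBool.encode d) :=
  rfl

/-- The code of the natural threshold `K` as a rational: numerator `K`, denominator `1`
(`Rat.num_natCast`, `Rat.den_natCast`, `encodeNat 1 = [true]`). [folklore] -/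
theorem boundedEncode_encodeRat_natCast (K : ℕ) :
    encodingRatBool.encode (K : ℚ) = boolPair (encodeInt (K : ℤ)) [true] := by
  show boolPair (encodeInt (K : ℚ).num) (encodeNat (K : ℚ).den) = _
  rw [Rat.num_natCast, Rat.den_natCast]
  rfl

/-- `|code of (K : ℚ)| ≤ 2 ⌊log₂ K⌋ + 17`. [folklore] -/
theorem boundedEncode_length_rat_le (K : ℕ) :
    (encodingRatBool.encode (K : ℚ)).length ≤ 2 * Nat.log 2 K + 17 := by
  rw [boundedEncode_encodeRat_natCast, length_boolPair]
  have h : (encodeInt (K : ℤ)).length ≤ Nat.log 2 (K : ℤ).natAbs + 7 := length_encodeInt_le_holds _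
  rw [Int.natAbs_natCast] at h
  simp only [List.length_singleton]
  omega

/-- `|code of B| ≤ 2 n² + 2 + n² (2 ⌊log₂ A⌋ + 16)` for an `n × n` integer matrix with entries of
absolute value `≤ A` (row-major `listBool` code of the `n²` entries; Micciancio–Goldwasser 2002,
Ch. 1, §1.3). [folklore] -/
theorem boundedEncode_length_matrix_le (n : ℕ) (B : Matrix (Fin n) (Fin n) ℤ) (A : ℕ)
    (hB : ∀ i j, (B i j).natAbs ≤ A) :
    ((encodingIntMatrixFin n).encode B).length ≤
      2 * (n * n) + 2 + (n * n) * (2 * Nat.log 2 A + 16) := by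
  change (encodingIntBool.listBool.encode (List.ofFn fun m : Fin (n * n) =>
    B (finProdFinEquiv.symm m).1 (finProdFinEquiv.symm m).2)).length ≤ _
  exact boundedEncode_length_listBool_ofFn_le _ A fun m => hB _ _

/-- `|code of t| ≤ 2 n + 2 + n (2 ⌊log₂ A⌋ + 16)` for an integer `n`-vector with entries of absolute
value `≤ A` (`listBool` code of the `n` entries). [folklore] -/
theorem boundedEncode_length_target_le (n : ℕ) (t : Fin n → ℤ) (A : ℕ) (ht : ∀ k, (t k).natAbs ≤ A) :
    ((encodingIntVecFin n).encode t).length ≤ 2 * n + 2 + n * (2 * Nat.log 2 A + 16) := by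
  change (encodingIntBool.listBool.encode (List.ofFn t)).length ≤ _
  exact boundedEncode_length_listBool_ofFn_le _ A ht

/-! ### The size bound -/

/-- **Bit-size of an entry-bounded `GapCVP` instance.** The code of `((⟨n, B⟩, t), K)` with integer
entries of absolute value `≤ A` and natural threshold `K` has length
`≤ 100 · ((n + 1)² · (⌊log₂ A⌋ + 1) + ⌊log₂ K⌋ + 1)`: with
`|code| = 2 (2 |bin n| + 2 + (2 |code B| + 2 + |code t|)) + 2 + |code K|`, where
`|bin n| ≤ n + 3`, `|code B| ≤ 2n² + 2 + n² (2L + 16)`, `|code t| ≤ 2n + 2 + n (2L + 16)`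
(`L = ⌊log₂ A⌋`) and `|code K| ≤ 2 ⌊log₂ K⌋ + 17` — the size of the input is polynomial in the
dimension and the bit length of the data (Micciancio–Goldwasser 2002, Ch. 1, §1.3; Arora–Barak
2009, §0.1). [folklore] -/
theorem bounded_encode_le (n : ℕ) (B : Matrix (Fin n) (Fin n) ℤ) (t : Fin n → ℤ) (A K : ℕ)
    (hB : ∀ i j, (B i j).natAbs ≤ A) (ht : ∀ k, (t k).natAbs ≤ A) :
    (GapCVPInstance.encode ((⟨⟨n, B⟩, t⟩, (K : ℚ)) : GapCVPInstance)).length ≤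
      100 * ((n + 1) ^ 2 * (Nat.log 2 A + 1) + Nat.log 2 K + 1) := by
  rw [boundedEncode_encode_eq]
  simp only [length_boolPair]
  have hh := boundedEncode_length_encodeNat_le n
  have hh' := Nat.log_le_self 2 n
  have hM := boundedEncode_length_matrix_le n B A hB
  have hV := boundedEncode_length_target_le n t A ht
  have hR := boundedEncode_length_rat_le K
  -- linearise the products for `omega`
  set L := Nat.log 2 A with hL
  obtain ⟨x, hx⟩ : ∃ x : ℕ, x = n * n := ⟨_, rfl⟩
  obtain ⟨y, hy⟩ : ∃ y : ℕ, y = x * L := ⟨_, rfl⟩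
  obtain ⟨w, hw⟩ : ∃ w : ℕ, w = n * L := ⟨_, rfl⟩
  have h1 : n * n * (2 * L + 16) = 2 * y + 16 * x := by rw [hy, hx]; ring
  have h2 : n * (2 * L + 16) = 2 * w + 16 * n := by rw [hw]; ring
  have h3 : (n + 1) ^ 2 * (L + 1) = y + x + 2 * w + 2 * n + L + 1 := by rw [hy, hw, hx]; ring
  rw [h3]
  rw [h1, ← hx] at hM
  rw [h2] at hV
  omega

end Summit.PneNP.PneNP.Theorems.ConAScaled
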